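import Literature.NumberTheory.EllipticCurves.BSDRootNumber
import Literature.NumberTheory.EllipticCurves.RootNumberProofs
import Literature.NumberTheory.DiophantineGeometry.MinimalDiscriminantRingOfIntegersProofs
import Literature.NumberTheory.DiophantineGeometry.MinimalDiscriminantSmulProofs
import HarnessLib

/-!
# BSD family — place-indexed versus prime-indexed local root numbers (proofs)

Sibling proof file of `Literature.NumberTheory.EllipticCurves.BSDRootNumber` (D-0014: the
statement file keeps the named fact `def … : Prop`; its discharge lives here, sorry-free). This
file discharges

* `Literature.NumberTheory.EllipticCurves.localRootNumberAt_primesEquiv_symm` by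
  `Literature.NumberTheory.EllipticCurves.localRootNumberAt_primesEquiv_symm_holds`: for an elliptic curve `E/ℚ` given by `W`, a
  prime `p` and the place `v = primesEquiv.symm p` of `ℤ`, the local root number
  `W.localRootNumberAt v` (Rohrlich's case list evaluated on the chosen `O_v`-minimal model of
  `W / ℚ_v`) equals `(W.baseChange ℚ_[p]).localRootNumber ℤ_[p]` (the same case list on the chosen
  `ℤ_[p]`-minimal model of `W / ℚ_[p]`).

## Proof architecture

The local root number `WeierstrassCurve.localRootNumber R X` (file `RootNumber`) is a function of
seven data of the chosen minimal model `M = X.minimal R`: the predicates `HasGoodReduction R M`,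
`HasMultiplicativeReduction R M`, `HasSplitMultiplicativeReduction R M`, the additive valuations
`ord (Δ)`, `ord (c₄)` of the integral model of `M`, and `q = #k`, `ℓ = char k` of the residue field.
Rohrlich's `W(E/K)` is an invariant of `E / K` (Rohrlich, CRM Proc. 4 (1994), §19); in Lean this is
the conjunction of two facts about these seven data.

* (*Independence of the minimal model*, Silverman, AEC VII.1, Prop. 1.3(b), PDF pp. 165–166:
  two minimal equations of an elliptic curve differ by `⟨u, r, s, t⟩` with `u ∈ R*`,
  `r, s, t ∈ R`; VII.2, PDF p. 166: hence the reduced equations are `k`-isomorphic; VII.5,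
  Definition and Prop. 5.1, PDF p. 174.) For two `K`-isomorphic minimal equations of an elliptic
  curve over a DVR `R ⊆ K` the three reduction predicates agree
  (`hasGoodReduction_iff_of_isMinimal_of_eq_smul`,
  `hasMultiplicativeReduction_iff_of_isMinimal_of_eq_smul`,
  `hasSplitMultiplicativeReduction_iff_of_isMinimal_of_eq_smul`, files `RootNumberProofs`,
  `LocalReductionProofs`) and so do `ord (Δ)`, `ord (c₄)` of the integral models
  (`addVal_Δ_integralModel_eq_of_isMinimal_of_eq_smul`,
  `addVal_c₄_integralModel_eq_of_isMinimal_of_eq_smul` below, from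
  `valuation_Δ_eq_of_isMinimal_of_eq_smul`, `valuation_c₄_eq_of_isMinimal_of_eq_smul`).
* (*Transport*, folklore: Silverman's definitions only involve the discretely valued field.) For
  compatible ring isomorphisms `ψ : R₁ ≃+* R₂`, `φ : K₁ ≃+* K₂` of DVR / fraction-field pairs and a
  *fixed* equation `X / K₁`, all seven data of `X` over `R₁` and of `X.map φ` over `R₂` agree: the
  integral models correspond under `ψ` (`integralModel_map_ringEquiv`), the valuations correspond
  (`Literature.NumberTheory.DiophantineGeometry.MinimalDiscriminant.valuation_maximalIdeal_ringEquiv`, `addVal_ringEquiv`), the node-tangent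
  polynomial of `HasSplitMultiplicativeReduction` commutes with `ψ` (`nodalTangents_map`) and its
  splitting over the residue field is read through `k₁ ≃+* k₂`
  (`hasMultiplicativeReduction_map_ringEquiv_iff`,
  `hasSplitMultiplicativeReduction_map_ringEquiv_iff`; minimality and good reduction are
  `isMinimal_map_iff`, `hasGoodReduction_map_iff` of file `RootNumberProofs`).
* `localRootNumber_map_ringEquiv`: hence `(X.map φ).localRootNumber R₂ = X.localRootNumber R₁` for
  an elliptic `X`: the image under `φ` of the chosen `R₁`-minimal model is an `R₂`-minimal equation
  `K₂`-isomorphic to the chosen `R₂`-minimal model of `X.map φ`.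
* `localRootNumberAt_eq_localRootNumber_padic`: specialise to Mathlib's
  `Rat.HeightOneSpectrum.adicCompletion.padicEquiv v : ℚ_v ≃A[ℚ] ℚ_[p]` and
  `adicCompletionIntegers.padicIntEquiv v : O_v ≃A[ℤ] ℤ_[p]` (`p = primesEquiv v`; the compatibility
  is `rfl`, and `ℚ →+* ℚ_[p]` is unique), stated for any integer ring `R` of `ℚ` as in
  `Literature.MinimalDiscriminant.ordMinimalDiscriminant_eq_padic` (for `R` literally `ℤ` the `ℤ`-algebra
  structure in the type of `padicIntEquiv` is not the instance found by unification, so the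
  `v`-indexed statement is proved for general `R` and then specialised); the named fact is the case
  `R = ℤ`, `v = primesEquiv.symm p`.

## References

* J. H. Silverman, *The Arithmetic of Elliptic Curves*, GTM 106, 2nd ed. 2009, §VII.1 (Definition of
  a minimal equation and Prop. 1.3(b), PDF pp. 165–166), §VII.2 (PDF p. 166), §VII.5 (Definition and
  Prop. 5.1, PDF p. 174).
* D. Rohrlich, *Elliptic curves and the Weil–Deligne group*, CRM Proc. Lecture Notes 4 (1994), §19.
-/

open IsDedekindDomain

/-! ### Two generic lemmas -/

namespace Literature.NumberTheory.EllipticCurves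

/-- If ring isomorphisms `ψ : R₁ ≃+* R₂`, `φ : K₁ ≃+* K₂` satisfy `φ ∘ algebraMap = algebraMap ∘ ψ`,
then `φ` maps the image of `R₁` in `K₁` onto the image of `R₂` in `K₂` (the hypothesis form of the
transport lemmas of file `RootNumberProofs`). [folklore] -/
theorem ringEquiv_mem_range_algebraMap_iff {R₁ K₁ R₂ K₂ : Type*} [CommRing R₁] [Field K₁]
    [Algebra R₁ K₁] [CommRing R₂] [Field K₂] [Algebra R₂ K₂] (ψ : R₁ ≃+* R₂) (φ : K₁ ≃+* K₂)
    (hc : ∀ r : R₁, φ (algebraMap R₁ K₁ r) = algebraMap R₂ K₂ (ψ r)) (x : K₁) :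
    φ x ∈ (algebraMap R₂ K₂).range ↔ x ∈ (algebraMap R₁ K₁).range := by
  constructor
  · rintro ⟨r, hr⟩
    refine ⟨ψ.symm r, ?_⟩
    rw [← Literature.NumberTheory.DiophantineGeometry.MinimalDiscriminant.ringEquiv_compat_symm ψ φ hc, hr, RingEquiv.symm_apply_apply]
  · rintro ⟨r, rfl⟩
    exact ⟨ψ r, (hc r).symm⟩

open IsLocalRing Polynomial in
/-- For an isomorphism `ψ : R₁ ≃+* R₂` of local rings and `f ∈ R₁[T]`: the reduction of `ψ (f)` to
the residue field of `R₂` splits iff the reduction of `f` to the residue field of `R₁` does (the two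
reductions correspond under the induced isomorphism of residue fields
`IsLocalRing.ResidueField.mapEquiv ψ`). [folklore] -/
theorem splits_map_residue_ringEquiv_iff {R₁ R₂ : Type*} [CommRing R₁] [IsLocalRing R₁]
    [CommRing R₂] [IsLocalRing R₂] (ψ : R₁ ≃+* R₂) (f : R₁[X]) :
    ((f.map (ψ : R₁ →+* R₂)).map (algebraMap R₂ (ResidueField R₂))).Splits ↔
      (f.map (algebraMap R₁ (ResidueField R₁))).Splits := by
  have hcomp : (algebraMap R₂ (ResidueField R₂)).comp (ψ : R₁ →+* R₂) =
      ((ResidueField.mapEquiv ψ : ResidueField R₁ ≃+* ResidueField R₂) :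
        ResidueField R₁ →+* ResidueField R₂).comp (algebraMap R₁ (ResidueField R₁)) :=
    RingHom.ext fun _ ↦ rfl
  rw [Polynomial.map_map, hcomp, ← Polynomial.map_map]
  refine ⟨fun h ↦ ?_, fun h ↦ h.map _⟩
  have h' := h.map ((ResidueField.mapEquiv ψ).symm : ResidueField R₂ →+* ResidueField R₁)
  rwa [Polynomial.map_map, RingEquiv.symm_comp, Polynomial.map_id] at h'

end Literature.NumberTheory.EllipticCurves

namespace WeierstrassCurve

/-! ### `ord (Δ)` and `ord (c₄)` of the integral model do not depend on the minimal model -/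

section SmulInvariance

variable (R : Type*) [CommRing R] [IsDomain R] [IsDiscreteValuationRing R]
  {K : Type*} [Field K] [Algebra R K] [IsFractionRing R K]
  {W₁ W₂ : WeierstrassCurve K} [IsMinimal R W₁] [IsMinimal R W₂] {D : VariableChange K}

open IsDiscreteValuationRing IsDedekindDomain.HeightOneSpectrum

/-- Two `K`-isomorphic minimal Weierstrass equations over the fraction field `K` of a DVR `R` have
integral models whose discriminants have the same additive valuation `ord (Δ)` (the *valuation of
the minimal discriminant* is well defined; Silverman, AEC VII.1, Definition, PDF p. 165, and
Prop. 1.3(b)). From `valuation_Δ_eq_of_isMinimal_of_eq_smul` (file `LocalReductionProofs`) and the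
bridge `IsDiscreteValuationRing.addVal_eq_addVal_of_valuation_algebraMap_eq` between Mathlib's two
valuations of a DVR. No ellipticity hypothesis is needed.
(Dot-notation extension of the Mathlib namespace `WeierstrassCurve`.)
[cite: SilvermanAEC2009, VII.1 Definition (PDF p. 165) and Prop. 1.3(b)] -/
theorem addVal_Δ_integralModel_eq_of_isMinimal_of_eq_smul (h : W₂ = D • W₁) :
    addVal R (W₂.integralModel R).Δ = addVal R (W₁.integralModel R).Δ := by
  apply addVal_eq_addVal_of_valuation_algebraMap_eq R (L := K)
  rw [integralModel_Δ_eq, integralModel_Δ_eq]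
  exact valuation_Δ_eq_of_isMinimal_of_eq_smul R h

/-- Two `K`-isomorphic minimal Weierstrass equations of an elliptic curve (`Δ ≠ 0`) over the
fraction field `K` of a DVR `R` have integral models whose covariants `c₄` have the same additive
valuation `ord (c₄)`: the relating change of variables has `u ∈ R*` (Silverman, AEC VII.1,
Prop. 1.3(b), PDF p. 165) and `c₄' = u⁻⁴ c₄` (Remark 1.1). From
`valuation_c₄_eq_of_isMinimal_of_eq_smul` (file `LocalReductionProofs`).
(Dot-notation extension of the Mathlib namespace `WeierstrassCurve`.)
[cite: SilvermanAEC2009, VII.1 Remark 1.1 and Prop. 1.3(b) (PDF p. 165)] -/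
theorem addVal_c₄_integralModel_eq_of_isMinimal_of_eq_smul (h : W₂ = D • W₁) (hΔ : W₁.Δ ≠ 0) :
    addVal R (W₂.integralModel R).c₄ = addVal R (W₁.integralModel R).c₄ := by
  apply addVal_eq_addVal_of_valuation_algebraMap_eq R (L := K)
  rw [integralModel_c₄_eq, integralModel_c₄_eq]
  exact valuation_c₄_eq_of_isMinimal_of_eq_smul R h hΔ

end SmulInvariance

/-! ### The node-tangent polynomial commutes with ring homomorphisms -/

section NodalTangents

open Polynomial

/-- The node-tangent polynomial `f_W (T) = c₄ T² + a₁ c₄ T − (54 b₆ − 3 b₂ b₄ + a₂ c₄)` of Mathlib's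
`WeierstrassCurve.HasSplitMultiplicativeReduction` (its roots are the slopes of the tangent lines at
the node; Silverman, AEC VII.5, Definition, PDF p. 174) commutes with ring homomorphisms:
`f_{W.map f} = f (f_W)`. (Dot-notation extension of the Mathlib namespace `WeierstrassCurve`.)
[folklore] -/
theorem nodalTangents_map {S T : Type*} [CommRing S] [CommRing T] (W : WeierstrassCurve S)
    (f : S →+* T) :
    C (W.map f).c₄ * X ^ 2 + C ((W.map f).a₁ * (W.map f).c₄) * X
        - C (54 * (W.map f).b₆ - 3 * (W.map f).b₂ * (W.map f).b₄ + (W.map f).a₂ * (W.map f).c₄) =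
      (C W.c₄ * X ^ 2 + C (W.a₁ * W.c₄) * X
        - C (54 * W.b₆ - 3 * W.b₂ * W.b₄ + W.a₂ * W.c₄)).map f := by
  simp only [Polynomial.map_sub, Polynomial.map_add, Polynomial.map_mul, Polynomial.map_pow, map_C,
    map_X, map_c₄, map_a₁, map_a₂, map_b₂, map_b₄, map_b₆, map_mul, map_sub, map_add, map_ofNat,
    Polynomial.map_ofNat]

end NodalTangents

/-! ### Transport along an isomorphism of discretely valued fields -/

section Transport

variable {R₁ K₁ R₂ K₂ : Type*}
  [CommRing R₁] [IsDomain R₁] [IsDiscreteValuationRing R₁] [Field K₁] [Algebra R₁ K₁]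
  [IsFractionRing R₁ K₁]
  [CommRing R₂] [IsDomain R₂] [IsDiscreteValuationRing R₂] [Field K₂] [Algebra R₂ K₂]
  [IsFractionRing R₂ K₂]
  (ψ : R₁ ≃+* R₂) (φ : K₁ ≃+* K₂)
  (hc : ∀ r : R₁, φ (algebraMap R₁ K₁ r) = algebraMap R₂ K₂ (ψ r))

open IsDiscreteValuationRing IsLocalRing IsDedekindDomain.HeightOneSpectrum Polynomial Literature.NumberTheory.DiophantineGeometry.MinimalDiscriminant Literature.NumberTheory.EllipticCurves

include hc in
omit [IsDomain R₁] [IsDiscreteValuationRing R₁] [IsFractionRing R₁ K₁] [IsDomain R₂]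
  [IsDiscreteValuationRing R₂] in
/-- For compatible ring isomorphisms `ψ : R₁ ≃+* R₂`, `φ : K₁ ≃+* K₂` (`φ ∘ algebraMap =
algebraMap ∘ ψ`, `K₂ = Frac R₂`), Mathlib's chosen integral models of an integral Weierstrass
equation `X / K₁` and of `X.map φ` correspond under `ψ`:
`integralModel R₂ (X.map φ) = (integralModel R₁ X).map ψ`, because `algebraMap R₂ K₂` is injective
and both sides base-change to `X.map φ`. [folklore] -/
theorem integralModel_map_ringEquiv (X : WeierstrassCurve K₁) [IsIntegral R₁ X]
    [IsIntegral R₂ (X.map (φ : K₁ →+* K₂))] :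
    (X.map (φ : K₁ →+* K₂)).integralModel R₂ = (X.integralModel R₁).map (ψ : R₁ →+* R₂) := by
  apply WeierstrassCurve.map_injective (f := algebraMap R₂ K₂) (IsFractionRing.injective R₂ K₂)
  have e₁ : (X.integralModel R₁).map (algebraMap R₁ K₁) = X := baseChange_integralModel_eq R₁ X
  have e₂ : ((X.map (φ : K₁ →+* K₂)).integralModel R₂).map (algebraMap R₂ K₂) =
      X.map (φ : K₁ →+* K₂) := baseChange_integralModel_eq R₂ _
  simp only
  rw [e₂, map_map]
  conv_lhs => rw [← e₁, map_map]
  congr 1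
  ext r
  exact hc r

include ψ hc in
/-- Multiplicative reduction (Silverman, AEC VII.5, Definition and Prop. 5.1(b), PDF p. 174: a
minimal equation with `v (Δ) > 0`, `v (c₄) = 0`) is transported along compatible ring isomorphisms
`(R₁ ⊆ K₁) ≃ (R₂ ⊆ K₂)` of DVR / fraction-field pairs: minimality corresponds (`isMinimal_map_iff`)
and `v₂ ∘ φ = v₁` (`Literature.NumberTheory.DiophantineGeometry.MinimalDiscriminant.valuation_maximalIdeal_ringEquiv`).
[cite: SilvermanAEC2009, VII.5 Prop. 5.1(b) (PDF p. 174)] -/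
theorem hasMultiplicativeReduction_map_ringEquiv_iff (X : WeierstrassCurve K₁) :
    (X.map (φ : K₁ →+* K₂)).HasMultiplicativeReduction R₂ ↔ X.HasMultiplicativeReduction R₁ := by
  rw [hasMultiplicativeReduction_iff, hasMultiplicativeReduction_iff, map_Δ, map_c₄,
    RingEquiv.coe_toRingHom, valuation_maximalIdeal_ringEquiv ψ φ hc,
    valuation_maximalIdeal_ringEquiv ψ φ hc,
    isMinimal_map_iff φ (ringEquiv_mem_range_algebraMap_iff ψ φ hc)]

include ψ hc in
/-- Split multiplicative reduction (Silverman, AEC VII.5, Definition, PDF p. 174: multiplicative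
reduction such that the slopes of the tangent lines at the node of the reduced minimal equation lie
in the residue field `k`) is transported along compatible ring isomorphisms
`(R₁ ⊆ K₁) ≃ (R₂ ⊆ K₂)` of DVR / fraction-field pairs: the integral models correspond under `ψ`
(`integralModel_map_ringEquiv`), so do the node-tangent polynomials of Mathlib's
`HasSplitMultiplicativeReduction` (`nodalTangents_map`), and their reductions correspond under the
induced isomorphism of residue fields `k₁ ≃+* k₂`, which preserves `Polynomial.Splits`
(`Literature.NumberTheory.EllipticCurves.splits_map_residue_ringEquiv_iff`).
[cite: SilvermanAEC2009, VII.5 Definition (PDF p. 174)] -/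
theorem hasSplitMultiplicativeReduction_map_ringEquiv_iff (X : WeierstrassCurve K₁) :
    (X.map (φ : K₁ →+* K₂)).HasSplitMultiplicativeReduction R₂ ↔
      X.HasSplitMultiplicativeReduction R₁ := by
  have hm := hasMultiplicativeReduction_map_ringEquiv_iff ψ φ hc X
  rw [hasSplitMultiplicativeReduction_iff, hasSplitMultiplicativeReduction_iff]
  constructor
  · rintro ⟨h₁, h₂⟩
    haveI : X.HasMultiplicativeReduction R₁ := hm.mp h₁
    refine ⟨inferInstance, ?_⟩
    rwa [integralModel_map_ringEquiv ψ φ hc X, nodalTangents_map,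
      splits_map_residue_ringEquiv_iff] at h₂
  · rintro ⟨h₁, h₂⟩
    haveI : (X.map (φ : K₁ →+* K₂)).HasMultiplicativeReduction R₂ := hm.mpr h₁
    refine ⟨inferInstance, ?_⟩
    rwa [integralModel_map_ringEquiv ψ φ hc X, nodalTangents_map, splits_map_residue_ringEquiv_iff]

include ψ hc in
/-- **The local root number is an invariant of the discretely valued field.** For compatible ring
isomorphisms `ψ : R₁ ≃+* R₂`, `φ : K₁ ≃+* K₂` of DVR / fraction-field pairs and an elliptic
`X / K₁`, Rohrlich's local root number (the case list `WeierstrassCurve.localRootNumber`,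
evaluated on Mathlib's chosen minimal models) satisfies
`(X.map φ).localRootNumber R₂ = X.localRootNumber R₁`.
The image under `φ` of the chosen `R₁`-minimal model `M₁` is an `R₂`-minimal equation
(`isMinimal_map_iff`) that is `K₂`-isomorphic to the chosen `R₂`-minimal model `M₂` of `X.map φ`;
the seven data entering the case list (good / multiplicative / split multiplicative reduction,
`ord (Δ)`, `ord (c₄)` of the integral model, `#k`, `char k`) agree for `M₂` and `M₁.map φ` by the
uniqueness of minimal equations up to `u ∈ R*`, `r, s, t ∈ R` (Silverman, AEC VII.1, Prop. 1.3(b),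
PDF pp. 165–166; VII.2, PDF p. 166; VII.5, Definition and Prop. 5.1, PDF p. 174) and for `M₁.map φ`
and `M₁` by transport. (Rohrlich, CRM Proc. 4 (1994), §19: `W(E/K)` is attached to `E / K`.)
[cite: SilvermanAEC2009, VII.1 Prop. 1.3(b) (PDF pp. 165–166) and VII.5 Prop. 5.1 (PDF p. 174)]
[cite: Rohrlich1994CRM, §19] -/
theorem localRootNumber_map_ringEquiv (X : WeierstrassCurve K₁) [X.IsElliptic] :
    (X.map (φ : K₁ →+* K₂)).localRootNumber R₂ = X.localRootNumber R₁ := by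
  classical
  have he := ringEquiv_mem_range_algebraMap_iff ψ φ hc
  -- the two chosen minimal models, and the image of the first one under `φ`
  obtain ⟨C₁, hC₁⟩ : ∃ C : VariableChange K₁, X.minimal R₁ = C • X := ⟨_, rfl⟩
  obtain ⟨C₂, hC₂⟩ : ∃ C : VariableChange K₂,
      (X.map (φ : K₁ →+* K₂)).minimal R₂ = C • X.map (φ : K₁ →+* K₂) := ⟨_, rfl⟩
  haveI hmin : ((X.minimal R₁).map (φ : K₁ →+* K₂)).IsMinimal R₂ :=
    (isMinimal_map_iff φ he _).mpr inferInstance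
  haveI : (X.minimal R₁).IsElliptic := by rw [hC₁]; infer_instance
  have hΔ : ((X.minimal R₁).map (φ : K₁ →+* K₂)).Δ ≠ 0 :=
    ((X.minimal R₁).map (φ : K₁ →+* K₂)).isUnit_Δ.ne_zero
  have hrel : (X.map (φ : K₁ →+* K₂)).minimal R₂ =
      (C₂ * (C₁.map (φ : K₁ →+* K₂))⁻¹) • (X.minimal R₁).map (φ : K₁ →+* K₂) := by
    rw [hC₂, hC₁, ← map_variableChange, mul_smul, inv_smul_smul]
  -- the seven data of Rohrlich's case list agree
  have hg : ((X.map (φ : K₁ →+* K₂)).minimal R₂).HasGoodReduction R₂ ↔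
      (X.minimal R₁).HasGoodReduction R₁ := by
    rw [hasGoodReduction_iff_of_isMinimal_of_eq_smul R₂ hrel, hasGoodReduction_map_iff φ he]
  have hm : ((X.map (φ : K₁ →+* K₂)).minimal R₂).HasMultiplicativeReduction R₂ ↔
      (X.minimal R₁).HasMultiplicativeReduction R₁ := by
    rw [hasMultiplicativeReduction_iff_of_isMinimal_of_eq_smul R₂ hrel hΔ,
      hasMultiplicativeReduction_map_ringEquiv_iff ψ φ hc]
  have hs : ((X.map (φ : K₁ →+* K₂)).minimal R₂).HasSplitMultiplicativeReduction R₂ ↔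
      (X.minimal R₁).HasSplitMultiplicativeReduction R₁ := by
    rw [hasSplitMultiplicativeReduction_iff_of_isMinimal_of_eq_smul R₂ hrel hΔ,
      hasSplitMultiplicativeReduction_map_ringEquiv_iff ψ φ hc]
  have hvΔ : addVal R₂ (((X.map (φ : K₁ →+* K₂)).minimal R₂).integralModel R₂).Δ =
      addVal R₁ ((X.minimal R₁).integralModel R₁).Δ := by
    rw [addVal_Δ_integralModel_eq_of_isMinimal_of_eq_smul R₂ hrel,
      integralModel_map_ringEquiv ψ φ hc, map_Δ, RingEquiv.coe_toRingHom, addVal_ringEquiv]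
  have hvc₄ : addVal R₂ (((X.map (φ : K₁ →+* K₂)).minimal R₂).integralModel R₂).c₄ =
      addVal R₁ ((X.minimal R₁).integralModel R₁).c₄ := by
    rw [addVal_c₄_integralModel_eq_of_isMinimal_of_eq_smul R₂ hrel hΔ,
      integralModel_map_ringEquiv ψ φ hc, map_c₄, RingEquiv.coe_toRingHom, addVal_ringEquiv]
  -- the residue fields correspond under `IsLocalRing.ResidueField.mapEquiv ψ`
  have hq : Nat.card (ResidueField R₂) = Nat.card (ResidueField R₁) :=
    (Nat.card_congr (ResidueField.mapEquiv ψ).toEquiv).symm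
  have hℓ : ringChar (ResidueField R₂) = ringChar (ResidueField R₁) :=
    haveI := ringChar.charP (ResidueField R₁)
    ringChar.eq_iff.mpr (charP_of_injective_ringHom (ResidueField.mapEquiv ψ).injective _)
  simp only [localRootNumber, hg, hm, hs, hvΔ, hvc₄, hq, hℓ]

end Transport

/-! ### The isomorphism `ℚ_v ≃ ℚ_[p]` -/

section Padic

open Rat.HeightOneSpectrum IsDiscreteValuationRing

variable {R : Type*} [CommRing R] [IsDedekindDomain R] [Algebra R ℚ] [IsFractionRing R ℚ]
  [IsIntegralClosure R ℤ ℚ]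

/-- `v`-indexed form of the discharge, for any integer ring `R` of `ℚ` (`R = ℤ` or `R = 𝓞 ℚ`): for
an elliptic curve `E/ℚ` given by `W`, a finite place `v` of `R` and `p = primesEquiv v`, the local
root number of `W` at `v` (Rohrlich's case list on the chosen `O_v`-minimal model of `W / ℚ_v`)
equals the local root number of `W / ℚ_[p]` over `ℤ_[p]`. Transport along Mathlib's
`adicCompletion.padicEquiv v : ℚ_v ≃A[ℚ] ℚ_[p]`, `adicCompletionIntegers.padicIntEquiv v :
O_v ≃A[ℤ] ℤ_[p]` (compatible by `rfl`; `ℚ →+* ℚ_[p]` is unique, so `W / ℚ_v` is mapped to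
`W / ℚ_[p]`) by `localRootNumber_map_ringEquiv`. (`Fact p.Prime` is supplied inline.)
Silverman, AEC VII.1, Prop. 1.3(b) and VII.5, Prop. 5.1; Rohrlich, CRM Proc. 4 (1994), §19.
[cite: SilvermanAEC2009, VII.1 Prop. 1.3(b) (PDF pp. 165–166) and VII.5 Prop. 5.1 (PDF p. 174)]
[cite: Rohrlich1994CRM, §19] -/
theorem localRootNumberAt_eq_localRootNumber_padic (W : WeierstrassCurve ℚ) [W.IsElliptic]
    (v : HeightOneSpectrum R) :
    haveI : Fact (primesEquiv v).1.Prime := ⟨(primesEquiv v).2⟩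
    W.localRootNumberAt v =
      (W.baseChange ℚ_[primesEquiv v]).localRootNumber ℤ_[primesEquiv v] := by
  have _inst (p : Nat.Primes) : Fact p.1.Prime := ⟨p.2⟩
  have hc : ∀ r : v.adicCompletionIntegers ℚ,
      (adicCompletion.padicEquiv v).toRingEquiv (algebraMap _ (v.adicCompletion ℚ) r) =
        algebraMap ℤ_[primesEquiv v] ℚ_[primesEquiv v]
          ((adicCompletionIntegers.padicIntEquiv v).toRingEquiv r) := fun r ↦ rfl
  -- `padicEquiv v` maps `W / ℚ_v` to `W / ℚ_[p]` (`ℚ →+* ℚ_[p]` is unique)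
  have hW : (W.baseChange (v.adicCompletion ℚ)).map
      ((adicCompletion.padicEquiv v).toRingEquiv : v.adicCompletion ℚ →+* ℚ_[primesEquiv v]) =
        W.baseChange ℚ_[primesEquiv v] := by
    rw [baseChange, baseChange, map_map]
    congr 1
    exact Subsingleton.elim _ _
  haveI : (W.baseChange (v.adicCompletion ℚ)).IsElliptic := by unfold baseChange; infer_instance
  rw [localRootNumberAt, ← hW, localRootNumber_map_ringEquiv _ _ hc]

end Padic

end WeierstrassCurve

/-! ### Discharge of `Literature.NumberTheory.EllipticCurves.localRootNumberAt_primesEquiv_symm` -/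

namespace Literature.NumberTheory.EllipticCurves

open Rat.HeightOneSpectrum

/-- **Discharge** of the named fact `Literature.NumberTheory.EllipticCurves.localRootNumberAt_primesEquiv_symm` (**bsd.S36**,
place-indexed versus prime-indexed local root numbers over `ℚ`): for an elliptic curve `E/ℚ` given
by `W`, a prime `p` and the place `v = primesEquiv.symm p` of `ℤ`,
`W.localRootNumberAt v = (W.baseChange ℚ_[p]).localRootNumber ℤ_[p]`. This is
`WeierstrassCurve.localRootNumberAt_eq_localRootNumber_padic` at `R = ℤ`, `v = primesEquiv.symm p`:
transport along the isomorphism of discretely valued fields `ℚ_v ≃ ℚ_[p]`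
(`Rat.HeightOneSpectrum.adicCompletion.padicEquiv`) and independence of Rohrlich's case list from
the chosen minimal model of an *elliptic* curve (Silverman, AEC VII.1, Prop. 1.3(b); VII.5,
Prop. 5.1). Rohrlich, CRM Proc. 4 (1994), §19.
[cite: SilvermanAEC2009, VII.1 Prop. 1.3(b) (PDF pp. 165–166) and VII.5 Prop. 5.1 (PDF p. 174)]
[cite: Rohrlich1994CRM, §19] -/
theorem localRootNumberAt_primesEquiv_symm_holds : localRootNumberAt_primesEquiv_symm := by
  intro W _ p
  obtain ⟨v, rfl⟩ := (primesEquiv (R := ℤ)).surjective p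
  rw [Equiv.symm_apply_apply]
  exact W.localRootNumberAt_eq_localRootNumber_padic v

end Literature.NumberTheory.EllipticCurves
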